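import Summits.Ventures.QEC.Census.CertCheckBZSound
import HarnessLib

/-!
# Soundness of the Brouwer–Zimmermann branch WITH AUTOMORPHISMS (`bz_aut`) — the checker side
# (plan/CERT-FORMAT.md v1.1 §5.5, lemma L6; census/search-1/BZ-CHECKER-SPEC.md §C5 `bz_aut`, §L L6 "Use (cover)")

Method `bz_aut` certifies only REPRESENTATIVE blocks and covers the remaining labels by automorphism images
(for the bivariate-bicycle codes: the `ℤ_ℓ × ℤ_m` translations). The per-block replay is unchanged (`bzBlockOK` of
`Census/CertCheckBZ.lean`, soundness `block_sound` of `Census/CertCheckBZSound.lean`); what changes is the cover: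
the plain bitmap check `coverOK` is replaced by a cover through label-action matrices `ρ_a` (type-12's
`Census/BB/…/OrbitBZCover.lean` for translations), and the transports `φ_a` (non-trivial logicals ↦ non-trivial
logicals of the same weight, acting on labels by `ρ_a`) come from type-12/type-07's automorphism lemmas
(`OrbitReduction`, `AutomorphismLabelAction`, `BZAutBBFlat`).

This file is the generic checker-side assembly, parametric in the transports:
* `bzCoreOK` — the structural checks of a side WITHOUT the cover (O3 rank certificates, O4 pairing,
  `n = r_syn + r_stab + k`, C2 parity);
* `bzAut_lower_sound` — `bzCoreOK`, `bzLenOK`, every representative block chunk `bzBlockOK`, abstract transports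
  `(φ_a, ρ_a)` with their two properties, and a cover hypothesis in the exact shape of type-07's `bz_cover`
  (`∀ λ ≠ 0, (∃ b, λ ∈ span W_b) ∨ ∃ a b, ρ_a λ ∈ span W_b`) ⇒ every non-trivial logical has weight `> wmax`;
* `testBit_coverMask_imp_exists_span` — the plug between the checker's cover bitmap and that hypothesis
  (`coverMask` bit `w` ⇒ `ofBits k w ∈ span W_b` for some block `b`), for type-12's `coverAutOK_sound`.
No distance value is asserted here.
-/

namespace Summit.Ventures.QEC.Census

open Matrix Finset Literature.InformationTheory.QuantumCodes Literature.InformationTheory.Coding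

/-- The structural checks of a side WITHOUT the label cover: the two rank certificates (type-02), the pairing
`logOK`, the dimension identity `n = r_syn + r_stab + k`, and the optional parity witness (type-06). (definition) -/
def bzCoreOK (n : ℕ) (Hsyn Hstab : List ℕ) (rcY rcS : RankCert) (L Ld : List ℕ) (ew : Option (List ℕ)) : Bool :=
  rcY.check n Hsyn && rcS.check n Hstab && logOK n Hsyn Hstab L Ld && (n == rcY.r + rcS.r + L.length) &&
    parityPartOK n Hsyn ew

/-- The plain structural check contains the core check. -/
theorem bzCoreOK_of_bzStructOK {n : ℕ} {Hsyn Hstab : List ℕ} {rcY rcS : RankCert} {L Ld : List ℕ} {s : BZSide}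
    (h : bzStructOK n Hsyn Hstab rcY rcS L Ld s = true) : bzCoreOK n Hsyn Hstab rcY rcS L Ld s.evenWitness = true := by
  simp only [bzStructOK, Bool.and_eq_true] at h
  simp only [bzCoreOK, Bool.and_eq_true]
  exact ⟨⟨⟨⟨h.1.1.1.1.1.1.1, h.1.1.1.1.1.1.2⟩, h.1.1.1.1.1.2⟩, h.1.1.1.1.2⟩, h.1.2⟩

/-- **The cover plug**: a set bit `w` of the checker's cover bitmap means `ofBits k w ∈ span W_b` for some block `b`
(the property type-12's `coverAutOK_sound` asks of its predicate). -/
theorem testBit_coverMask_imp_exists_span (k : ℕ) (blocks : List BZBlock) {w : ℕ}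
    (h : (coverMask blocks).testBit w = true) :
    ∃ b : Fin blocks.length, ofBits k w ∈ Submodule.span (ZMod 2)
      (Set.range fun l : Fin (blocks[b]).W.length => ofBits k (blocks[b]).W[l]) := by
  obtain ⟨b, hx⟩ := exists_mem_subsetXors_of_testBit_coverMask blocks h
  refine ⟨b, ?_⟩
  rw [← setOf_ofBits_mem_eq_range]
  exact mem_span_of_mem_subsetXors k _ hx

section Side

variable {n : ℕ} {Hsyn Hstab : List ℕ} {rcY rcS : RankCert} {L Ld : List ℕ} {found : List (ℕ × List ℕ)}
  {wmax : ℕ} {s : BZSide}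

/-- **One side, method `bz_aut`** (BZ-CHECKER-SPEC §L L6 "Use (cover)"): the core structural check, the row-count
check, every (representative) block chunk, transports `φ_a` that send non-trivial logicals to non-trivial logicals
of the same weight acting on labels by `ρ_a`, and the cover "every nonzero label, or one of its images `ρ_a λ`,
lies in some `span W_b`" ⇒ every `z ∈ ker Hsyn ∖ rowspace Hstab` has weight `> wmax`. Discharges type-07's
`bz_cover` (p467446); the parity upgrade uses type-06's `CertParity`. -/
theorem bzAut_lower_sound (hcomm : rowMatrix n Hsyn * (rowMatrix n Hstab)ᵀ = 0) (hfound : foundOK Hstab found = true)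
    (hcore : bzCoreOK n Hsyn Hstab rcY rcS L Ld s.evenWitness = true) (hlen : bzLenOK Hstab rcS L s = true)
    (hb : ∀ b : ℕ, b < s.blocks.length → bzBlockOK n Hstab rcS L wmax (found.map Prod.fst) s b = true)
    {α : Type*} (φ : α → (Fin n → ZMod 2) → (Fin n → ZMod 2))
    (ρ : α → Matrix (Fin L.length) (Fin L.length) (ZMod 2))
    (hφ : ∀ a (z : Fin n → ZMod 2), rowMatrix n Hsyn *ᵥ z = 0 → z ∉ rowSpace (rowMatrix n Hstab) →
      rowMatrix n Hsyn *ᵥ φ a z = 0 ∧ φ a z ∉ rowSpace (rowMatrix n Hstab) ∧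
        hammingNorm (φ a z) = hammingNorm z ∧ ldMat n L Ld *ᵥ φ a z = ρ a *ᵥ (ldMat n L Ld *ᵥ z))
    (hcover : ∀ lam : Fin L.length → ZMod 2, lam ≠ 0 →
      (∃ b : Fin s.blocks.length, lam ∈ Submodule.span (ZMod 2)
        (Set.range fun l : Fin (s.blocks[b]).W.length => ofBits L.length (s.blocks[b]).W[l])) ∨
      ∃ (a : α) (b : Fin s.blocks.length), ρ a *ᵥ lam ∈ Submodule.span (ZMod 2)
        (Set.range fun l : Fin (s.blocks[b]).W.length => ofBits L.length (s.blocks[b]).W[l]))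
    (w : Fin n → ZMod 2) (hw : rowMatrix n Hsyn *ᵥ w = 0) (hw' : w ∉ rowSpace (rowMatrix n Hstab)) :
    wmax < hammingNorm w := by
  rcases Nat.eq_zero_or_pos n with hn0 | hn
  · subst hn0
    exfalso
    apply hw'
    have : w = 0 := funext fun i => i.elim0
    rw [this]
    exact Submodule.zero_mem _
  simp only [bzCoreOK, Bool.and_eq_true, beq_iff_eq] at hcore
  obtain ⟨⟨⟨⟨hY, hS⟩, hL⟩, hdim⟩, hpar⟩ := hcore
  simp only [bzLenOK, List.all_eq_true] at hlen
  let C := CSSCode.ofMatrices (rowMatrix n Hsyn) (rowMatrix n Hstab) hcomm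
  have hblock : ∀ (b : Fin s.blocks.length) (z : Fin n → ZMod 2), rowMatrix n Hsyn *ᵥ z = 0 →
      z ∉ rowSpace (rowMatrix n Hstab) → ldMat n L Ld *ᵥ z ∈
        ((Submodule.span (ZMod 2) (Set.range fun l : Fin (s.blocks[b]).W.length =>
          ofBits L.length (s.blocks[b]).W[l]) : Submodule (ZMod 2) (Fin L.length → ZMod 2)) : Set _) →
      wEff wmax s.evenWitness < hammingNorm z := by
    intro b z hz hz' hlab
    have hbb := hb b b.2
    simp only [bzBlockOK, List.getElem?_eq_getElem b.2] at hbb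
    have hlenb : ((s.blocks[b]).mats.all fun mt => mt.A.length == (gbRows Hstab rcS L (s.blocks[b])).length) = true := by
      rw [List.all_eq_true]
      exact hlen _ (List.getElem_mem b.2)
    have := block_sound hn hcomm hY hS hL hdim hfound (Nat.succ_le_succ (wEff_le wmax s.evenWitness))
      (s.blocks[b]) hbb hlenb hz hz' hlab
    omega
  have key : wEff wmax s.evenWitness < hammingNorm w :=
    bz_cover C (L := logVec n L) (Ld := ldMat n L Ld) (fun j => mulVec_dual_eq_zero hL j)
      (fun i j => dual_dotProduct_logVec hL i j) (fun z hz => exists_coeffs_of_ker hcomm hY hS hL hdim hz)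
      (fun b : Fin s.blocks.length => ((Submodule.span (ZMod 2) (Set.range fun l : Fin (s.blocks[b]).W.length =>
          ofBits L.length (s.blocks[b]).W[l]) : Submodule (ZMod 2) (Fin L.length → ZMod 2)) : Set _))
      hblock φ ρ hφ
      (fun lam hlam => by
        rcases hcover lam hlam with ⟨b, hb'⟩ | ⟨a, b, hab⟩
        · exact Or.inl ⟨b, hb'⟩
        · exact Or.inr ⟨a, b, hab⟩)
      hw hw'
  cases hew : s.evenWitness with
  | none => simpa [wEff, hew] using key
  | some sel =>
    rw [hew] at key hpar
    simp only [parityPartOK] at hpar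
    exact lt_hammingNorm_of_even C (fun z hz => even_hammingNorm_of_parityOK hpar hz) hw
      (by simpa [wEff] using key)

end Side

/-! ## Control: method `bz` is the no-automorphism case (Steane, with the empty transport family) -/

/-- Sanity check of the `bz_aut` assembly on the Steane certificate with NO automorphisms (`α = Empty`): the
cover hypothesis is then the plain cover, discharged by `exists_block_of_coverOK`. -/
theorem steane_bzAut_noAut (w : Fin 7 → ZMod 2) (hw : rowMatrix 7 certSteane7.HX *ᵥ w = 0)
    (hw' : w ∉ rowSpace (rowMatrix 7 certSteane7.HZ)) : 2 < hammingNorm w :=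
  bzAut_lower_sound (rcY := bzSteane.rcX) (rcS := bzSteane.rcZ) (L := bzSteane.LZ) (Ld := bzSteane.LX)
    (found := certSteane7.sideZ.found) (s := bzSteane.sideZ)
    (comm_of_commOK (by decide)) (by decide) (by decide) (by decide)
    (fun b hb => by change b < 1 at hb; interval_cases b; decide)
    (α := Empty) (fun a => a.elim) (fun a => a.elim) (fun a => a.elim)
    (fun lam hlam => Or.inl (exists_block_of_coverOK (by decide) lam hlam)) w hw hw'

end Summit.Ventures.QEC.Census
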